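import Summits.QuantumFields.BalabanUV.T4Continuum.Support.VariationalColourUpperBound
import Summits.QuantumFields.BalabanUV.T4Continuum.Support.VariationalCovariantScalarPair

/-!
# T⁴ programme, spine node NE2 (U1a), lane P2 — SUPPLIER ITEM (O8) «V-COL-PAIR»: THE COLOUR CANONICAL PAIR — the additive bracket of
# `VariationalCovariantAssembly.pair_bracket` instantiated for 0-forms with values in a finite-dimensional Hilbert space `E`, with leaf
# FED⁺-colour DISCHARGED (`VariationalColourFederbush`, p214930) and UB⁺ ∕ P⁺ ∕ ONE⁺ ∕ REG⁺ as displayed binders in the colour letters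
# (the colour re-run of the scalar capstone `VariationalCovariantScalarPair` (p211992) minus its §4 global-frame P⁺ discharge)

NE2 formalisation swarm `b2b-balaban-t4-ne2-formalise-*`, leaf prover 02 (gen 4); P2 skeleton `t4/skeletons/NE2-t4-ne2-p2.md` v0.10 §2.E row
V-COL + §3 (assembly pattern).  Carriers: `VariationalColourFederbush.{Qcv, cDv, dirUv, misv, sum_dirUv_Qcv_le}` and leaf-03-g4's `nsqv`
(`VariationalColourUpperBound`, p215022) BY NAME; the abstract bracket `VariationalCovariantAssembly.pair_bracket` (owner, p211487) verbatim.
 * §1 THE COLOUR LETTERS (data; the E-valued twins of the scalar capstone's `Sc ∕ Sf ∕ qW ∕ qV ∕ Qk ∕ Q1`): `Scv n M Rc f = n²∕n^d·Σ_μ dirUv …`,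
   `Sfv`, `qWv n M f = n^{−d}·nsqv f`, `qVv`, `Qkv n M T f = Qcv n M T f`, `Q1v n L M T′ f′ = Qcv L (fine n M) T′ f′`;
 * §2 generic properties: nonnegativity, norm domination `‖f‖² ≤ nsqv f` (sup norm of the `Pi` carrier), continuity of `Qcv` and of the
   Dirichlet sums, surjectivity of `Q1v` for UNITARY one-step site operators (right inverse `x ↦ T′(x)⋆ (λ (blockOf x))`);
 * §3 **`Scv_Q1v_le`** — FED⁺-colour in physical units: `Scv (Q1v f′) ≤ (√(Sfv f′) + √d·(n·m)·√(qVv f′))²` (from `sum_dirUv_Qcv_le` by the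
   scaling `n²∕n^d`), the `hFED` binder of the abstract bracket DISCHARGED;
 * §4 **`colour_pair_bracket`**: for fine bond operators `‖R′‖ ≤ 1`, unitary one-step site operators `T′`, one-block mismatch
   `‖misv … Rc R′ T′‖ ≤ m`, and DISPLAYED leaf binders `hUBc`∕`hUBf` (UB⁺-colour: leaf-03-g4's `exists_ubv_phys` shape),
   `hPc`∕`hPf` (P⁺-colour — OPEN: leaf-09-g4's V-COL-LIFT + a frame ∕ local transport, (O6)), `hONE` (ONE⁺-colour: this seat's
   `VariationalColourOneStepPhys.blockSpin_Q1v_le_flat` shape), `hREG` (REG⁺-colour: leaf-09-g4's `VariationalColourBochner` line):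
   `Δ′_k(μ) ≤ Δ′_{k+1}(μ) + e·nsqv μ` and `Δ′_{k+1}(μ) ≤ Δ′_k(μ) + e′·nsqv μ`, `e = 2δ√(Λ·C_P(Λ+1)) + δ²·C_P(Λ+1)`, `δ = √d·(n·m)`,
   `e′ = (ε₁C_R + ε₂C_P)(Λ+1)` — the scalar capstone's conclusion with `C_P` a binder instead of `1088d + 128`.
WHAT IS NOT HERE: the discharge of P⁺ (frames ∕ local Poincaré in colour), of UB⁺ ∕ ONE⁺ ∕ REG⁺ (they are the sibling files' theorems, plugged
BY NAME by the consumer), the tower (COMP⁺-colour `VariationalColourTower` + the END pattern; the scalar road's composition caveats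
N-ne2p2g11-2 ∕ G-ne2leaf04g2-1 apply verbatim), any identification with Bałaban's objects (model level, c5).

HONEST FRAMING (T4-DAG p. 1).  Model level (operators DATA); [folklore] bookkeeping over the owner's kernel bracket; nothing printed is a
hypothesis (one `[cite:]` SHAPE locator inherited from the scalar `Sc`); no `def … : Prop`; no `sorry`; axioms standard.  NE2 NOT proved;
spine PROVED 0∕9; rung (B)+1 finite T⁴ — NOT infinite volume, NOT a mass gap, NOT Clay.  HONEST DEPENDENCY (cell, verbatim): continuum YM on
T⁴ ⇐ BetaPertH ∧ nine spine estimates (0/9 proved); BetaPertH ⇐ (D1) ∧ (D4) ∧ CAP+tail; G-an2-4 gates asym, D1 and NE2/3/4.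
-/

noncomputable section

namespace Summit.QuantumFields.BalabanUV.T4Continuum.VariationalColourScalarPair

open Finset
open Literature.MathematicalPhysics.QuantumFieldTheory.Balaban1983to89
open Literature.MathematicalPhysics.QuantumFieldTheory.Balaban1983to89.B5Prop11Plancherel (Tor fine unitVec)
open Literature.MathematicalPhysics.QuantumFieldTheory.Balaban1983to89.B5Block118 (bpt)
open Literature.MathematicalPhysics.QuantumFieldTheory.Balaban1983to89.B5Blocks16 (blockOf blockOf_bpt)
open Summit.QuantumFields.BalabanUV.T4Continuum.VariationalTransfer (blockSpin)
open Summit.QuantumFields.BalabanUV.T4Continuum.VariationalCovariantAssembly (pair_bracket)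
open Summit.QuantumFields.BalabanUV.T4Continuum.VariationalColourFederbush (cDv dirUv Qcv misv dirUv_nonneg sum_dirUv_Qcv_le)
open Summit.QuantumFields.BalabanUV.T4Continuum.VariationalColourUpperBound (nsqv nsqv_nonneg)

variable {d : ℕ} {E : Type*} [NormedAddCommGroup E] [InnerProductSpace ℂ E] [CompleteSpace E]
variable (n L : ℕ) [NeZero n] [NeZero L] (M : Fin d → ℕ) [hM : ∀ μ, NeZero (M μ)]

/-! ## §1 The colour letters: forms and sizes in physical units, the two averagings -/

/-- the level-`n` colour covariant Dirichlet form in physical units: `Scv f = n^{2−d}·Σ_{μ,x}‖Rc(x,μ)(f(x+e_μ)) − f(x)‖²`.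
[cite: Balaban1985BackgroundPropagators, (3.23) p.394 (shape)] [folklore] -/
def Scv (Rc : Tor (fine n M) → Fin d → (E →L[ℂ] E)) (f : Tor (fine n M) → E) : ℝ :=
  (n : ℝ) ^ 2 / (n : ℝ) ^ d * ∑ μ, dirUv (fine n M) Rc f μ

/-- the level-`nL` colour covariant Dirichlet form in physical units. [folklore] -/
def Sfv (R' : Tor (fine L (fine n M)) → Fin d → (E →L[ℂ] E)) (f' : Tor (fine L (fine n M)) → E) : ℝ :=
  ((n : ℝ) * L) ^ 2 / ((n : ℝ) * L) ^ d * ∑ μ, dirUv (fine L (fine n M)) R' f' μ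

omit [InnerProductSpace ℂ E] [CompleteSpace E] in
/-- `L²` size of a level-`n` field in physical units: `n^{−d}·Σ‖f‖²`. [folklore] -/
def qWv (f : Tor (fine n M) → E) : ℝ := ((n : ℝ) ^ d)⁻¹ * nsqv f

omit [InnerProductSpace ℂ E] [CompleteSpace E] in
/-- `L²` size of a level-`nL` field in physical units. [folklore] -/
def qVv (f' : Tor (fine L (fine n M)) → E) : ℝ := (((n : ℝ) * L) ^ d)⁻¹ * nsqv f'

/-- the k-block transported average `Q_T : (Tor (fine n M) → E) → (Tor M → E)`. [folklore] -/
def Qkv (T : Tor (fine n M) → (E →L[ℂ] E)) (f : Tor (fine n M) → E) : Tor M → E := fun z => Qcv n M T f z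

/-- the one-step transported average `Q_{T′} : (Tor (fine L (fine n M)) → E) → (Tor (fine n M) → E)`. [folklore] -/
def Q1v (T' : Tor (fine L (fine n M)) → (E →L[ℂ] E)) (f' : Tor (fine L (fine n M)) → E) : Tor (fine n M) → E :=
  fun y => Qcv L (fine n M) T' f' y

/-! ## §2 Generic properties: nonnegativity, norm domination, continuity, surjectivity -/

omit [CompleteSpace E] in
/-- the coarse form is nonnegative. [folklore] -/
theorem Scv_nonneg (Rc : Tor (fine n M) → Fin d → (E →L[ℂ] E)) (f : Tor (fine n M) → E) : 0 ≤ Scv n M Rc f :=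
  mul_nonneg (by positivity) (sum_nonneg fun μ _ => dirUv_nonneg _ _ _ _)

omit [CompleteSpace E] in
/-- the fine form is nonnegative. [folklore] -/
theorem Sfv_nonneg (R' : Tor (fine L (fine n M)) → Fin d → (E →L[ℂ] E)) (f' : Tor (fine L (fine n M)) → E) : 0 ≤ Sfv n L M R' f' :=
  mul_nonneg (by positivity) (sum_nonneg fun μ _ => dirUv_nonneg _ _ _ _)

omit [InnerProductSpace ℂ E] [CompleteSpace E] in
/-- the coarse size is nonnegative. [folklore] -/
theorem qWv_nonneg (f : Tor (fine n M) → E) : 0 ≤ qWv n M f := mul_nonneg (by positivity) (nsqv_nonneg f)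

omit [InnerProductSpace ℂ E] [CompleteSpace E] in
/-- the fine size is nonnegative. [folklore] -/
theorem qVv_nonneg (f' : Tor (fine L (fine n M)) → E) : 0 ≤ qVv n L M f' := mul_nonneg (by positivity) (nsqv_nonneg f')

omit [InnerProductSpace ℂ E] [CompleteSpace E] in
/-- the sup norm is dominated by the `ℓ²` mass: `‖f‖² ≤ Σ‖f x‖²`. [folklore] -/
theorem norm_sq_le_nsqv {ι : Type*} [Fintype ι] (f : ι → E) : ‖f‖ ^ 2 ≤ nsqv f := by
  have h0 : 0 ≤ nsqv f := nsqv_nonneg f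
  have h : ‖f‖ ≤ Real.sqrt (nsqv f) := by
    refine (pi_norm_le_iff_of_nonneg (Real.sqrt_nonneg _)).mpr fun i => ?_
    rw [← Real.sqrt_sq (norm_nonneg (f i))]
    refine Real.sqrt_le_sqrt ?_
    unfold nsqv
    exact Finset.single_le_sum (f := fun j => ‖f j‖ ^ 2) (fun j _ => sq_nonneg _) (Finset.mem_univ i)
  calc ‖f‖ ^ 2 ≤ Real.sqrt (nsqv f) ^ 2 := pow_le_pow_left₀ (norm_nonneg _) h 2
    _ = nsqv f := Real.sq_sqrt h0

omit [InnerProductSpace ℂ E] [CompleteSpace E] in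
/-- norm domination at level `n`: `‖f‖² ≤ n^d·qWv f`. [folklore] -/
theorem norm_sq_le_qWv (f : Tor (fine n M) → E) : ‖f‖ ^ 2 ≤ (n : ℝ) ^ d * qWv n M f := by
  have hn : (0 : ℝ) < (n : ℝ) ^ d := by have := NeZero.ne n; positivity
  rw [qWv, ← mul_assoc, mul_inv_cancel₀ hn.ne', one_mul]
  exact norm_sq_le_nsqv f

omit [InnerProductSpace ℂ E] [CompleteSpace E] in
/-- norm domination at level `nL`: `‖f′‖² ≤ (nL)^d·qVv f′`. [folklore] -/
theorem norm_sq_le_qVv (f' : Tor (fine L (fine n M)) → E) : ‖f'‖ ^ 2 ≤ ((n : ℝ) * L) ^ d * qVv n L M f' := by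
  have hn : (0 : ℝ) < ((n : ℝ) * L) ^ d := by have := NeZero.ne n; have := NeZero.ne L; positivity
  rw [qVv, ← mul_assoc, mul_inv_cancel₀ hn.ne', one_mul]
  exact norm_sq_le_nsqv f'

omit [CompleteSpace E] in
/-- the transported average is continuous (linear in the field, finite sums of continuous linear maps). [folklore] -/
theorem continuous_Qcv {Lb : ℕ} [NeZero Lb] {N : Fin d → ℕ} [∀ μ, NeZero (N μ)] (T' : Tor (fine Lb N) → (E →L[ℂ] E)) :
    Continuous fun f' : Tor (fine Lb N) → E => fun y => Qcv Lb N T' f' y := by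
  refine continuous_pi fun y => ?_
  unfold Qcv
  fun_prop

omit [CompleteSpace E] in
/-- the colour covariant Dirichlet sums are continuous. [folklore] -/
theorem continuous_sum_dirUv {N : Fin d → ℕ} [∀ μ, NeZero (N μ)] (R : Tor N → Fin d → (E →L[ℂ] E)) (c : ℝ) :
    Continuous fun f : Tor N → E => c * ∑ μ, dirUv N R f μ := by
  unfold dirUv cDv
  fun_prop

/-- unitary site operators: `T (T⋆ v) = v`. [folklore] -/
theorem apply_star_apply {T : E →L[ℂ] E} (hT : T ∈ unitary (E →L[ℂ] E)) (v : E) : T (star T v) = v := by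
  have h := congrArg (fun S : E →L[ℂ] E => S v) (Unitary.mem_iff.mp hT).2
  simpa only [mul_apply_eq_comp, one_apply_eq_self] using h

/-- the one-step transported average with UNITARY site operators is onto (right inverse: `f′ = T′⋆ (λ ∘ blockOf)`). [folklore] -/
theorem Q1v_surjective (T' : Tor (fine L (fine n M)) → (E →L[ℂ] E)) (hT1 : ∀ x, T' x ∈ unitary (E →L[ℂ] E)) :
    Function.Surjective (Q1v n L M T') := by
  intro lam
  refine ⟨fun x => star (T' x) (lam (blockOf L (fine n M) x)), ?_⟩
  funext y
  have hL : ((L : ℂ) ^ d) ≠ 0 := pow_ne_zero _ (by exact_mod_cast NeZero.ne L)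
  have hcard : (Finset.univ : Finset (Fin d → Fin L)).card = L ^ d := by
    rw [Finset.card_univ, Fintype.card_fun, Fintype.card_fin, Fintype.card_fin]
  simp only [Q1v, Qcv, blockOf_bpt]
  have : ∀ j : Fin d → Fin L, T' (bpt L (fine n M) y j) (star (T' (bpt L (fine n M) y j)) (lam y)) = lam y := fun j =>
    apply_star_apply (hT1 _) _
  simp_rw [this]
  rw [sum_const, hcard, ← Nat.cast_smul_eq_nsmul ℂ, smul_smul, Nat.cast_pow, inv_mul_cancel₀ hL, one_smul]

/-! ## §3 Leaf FED⁺-colour DISCHARGED in physical units -/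

omit [CompleteSpace E] in
/-- **FED⁺-colour (physical units)**: `Scv(Q_{T′} f′) ≤ (√Sfv(f′) + √d·(n·m)·√qVv(f′))²` (from `sum_dirUv_Qcv_le` by scaling with `n²∕n^d`). [folklore] -/
theorem Scv_Q1v_le {Rc : Tor (fine n M) → Fin d → (E →L[ℂ] E)} {R' : Tor (fine L (fine n M)) → Fin d → (E →L[ℂ] E)}
    {T' : Tor (fine L (fine n M)) → (E →L[ℂ] E)} (hR' : ∀ x μ, ‖R' x μ‖ ≤ 1) (hT' : ∀ x, ‖T' x‖ ≤ 1) {m : ℝ} (hm : 0 ≤ m)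
    (hmis : ∀ y μ j, ‖misv L (fine n M) Rc R' T' y μ j‖ ≤ m) (f' : Tor (fine L (fine n M)) → E) :
    Scv n M Rc (Q1v n L M T' f') ≤ (Real.sqrt (Sfv n L M R' f') + Real.sqrt d * ((n : ℝ) * m) * Real.sqrt (qVv n L M f')) ^ 2 := by
  have hn : (0 : ℝ) < (n : ℝ) := by exact_mod_cast Nat.pos_of_ne_zero (NeZero.ne n)
  have hnd : (0 : ℝ) < (n : ℝ) ^ d := by positivity
  have hLd : (0 : ℝ) < (L : ℝ) ^ d := by have := NeZero.ne L; positivity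
  set c : ℝ := (n : ℝ) ^ 2 / (n : ℝ) ^ d with hcdef
  have hc0 : 0 ≤ c := by positivity
  set DX : ℝ := ∑ μ, dirUv (fine L (fine n M)) R' f' μ with hDX
  set Y : ℝ := nsqv f' with hYdef
  have h : ∑ μ, dirUv (fine n M) Rc (Qcv L (fine n M) T' f') μ
      ≤ (Real.sqrt ((L : ℝ) ^ 2 * DX / (L : ℝ) ^ d) + Real.sqrt d * (m * Real.sqrt (Y / (L : ℝ) ^ d))) ^ 2 :=
    sum_dirUv_Qcv_le L (fine n M) Rc R' T' hR' hT' hm hmis f'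
  have hSc : Scv n M Rc (Q1v n L M T' f') = c * ∑ μ, dirUv (fine n M) Rc (Qcv L (fine n M) T' f') μ := rfl
  have hSf : Sfv n L M R' f' = ((n : ℝ) * L) ^ 2 / ((n : ℝ) * L) ^ d * DX := rfl
  have hqV : qVv n L M f' = (((n : ℝ) * L) ^ d)⁻¹ * Y := rfl
  have e1 : Real.sqrt c * Real.sqrt ((L : ℝ) ^ 2 * DX / (L : ℝ) ^ d) = Real.sqrt (Sfv n L M R' f') := by
    rw [← Real.sqrt_mul hc0, hSf]
    congr 1
    rw [hcdef, mul_pow, mul_pow]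
    field_simp
  have e2 : Real.sqrt c * (Real.sqrt d * (m * Real.sqrt (Y / (L : ℝ) ^ d)))
      = Real.sqrt d * ((n : ℝ) * m) * Real.sqrt (qVv n L M f') := by
    have h1 : Real.sqrt c * Real.sqrt (Y / (L : ℝ) ^ d) = n * Real.sqrt (qVv n L M f') := by
      have e : c * (Y / (L : ℝ) ^ d) = (n : ℝ) ^ 2 * qVv n L M f' := by
        rw [hqV, hcdef, mul_pow]; field_simp
      rw [← Real.sqrt_mul hc0, e, Real.sqrt_mul (sq_nonneg _), Real.sqrt_sq hn.le]
    calc Real.sqrt c * (Real.sqrt d * (m * Real.sqrt (Y / (L : ℝ) ^ d)))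
        = Real.sqrt d * m * (Real.sqrt c * Real.sqrt (Y / (L : ℝ) ^ d)) := by ring
      _ = _ := by rw [h1]; ring
  have hsq : Real.sqrt c ^ 2 = c := Real.sq_sqrt hc0
  have key : ∀ a b : ℝ, c * (a + b) ^ 2 = (Real.sqrt c * a + Real.sqrt c * b) ^ 2 := by
    intro a b
    calc c * (a + b) ^ 2 = Real.sqrt c ^ 2 * (a + b) ^ 2 := by rw [hsq]
      _ = (Real.sqrt c * a + Real.sqrt c * b) ^ 2 := by ring
  calc Scv n M Rc (Q1v n L M T' f') = c * ∑ μ, dirUv (fine n M) Rc (Qcv L (fine n M) T' f') μ := hSc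
    _ ≤ c * (Real.sqrt ((L : ℝ) ^ 2 * DX / (L : ℝ) ^ d) + Real.sqrt d * (m * Real.sqrt (Y / (L : ℝ) ^ d))) ^ 2 :=
        mul_le_mul_of_nonneg_left h hc0
    _ = (Real.sqrt c * Real.sqrt ((L : ℝ) ^ 2 * DX / (L : ℝ) ^ d)
          + Real.sqrt c * (Real.sqrt d * (m * Real.sqrt (Y / (L : ℝ) ^ d)))) ^ 2 := key _ _
    _ = _ := by rw [e1, e2]

/-! ## §4 THE COLOUR CANONICAL PAIR: the additive bracket with FED⁺-colour discharged -/

/-- **THE ADDITIVE BRACKET FOR THE COLOUR CANONICAL PAIR** (model level; `E` a finite-dimensional Hilbert space): for coarse bond operators `Rc`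
(level `n`), fine bond operators `R′` (level `nL`, `‖R′‖ ≤ 1`), site operators `T` (level `n`) and UNITARY one-step site operators `T′`, the
one-block mismatch `‖misv … Rc R′ T′‖ ≤ m`, and ASSUMING the four sibling leaves as displayed binders in the colour letters — UB⁺ (both levels,
constant `Λ`), P⁺ (both levels, constant `C_P`), ONE⁺ (regularity functional `ρ`, constants `ε₁, ε₂`), REG⁺ (`C_R`) — for every unit datum `μ`:
`Δ′_k(μ) ≤ Δ′_{k+1}(μ) + e·nsqv μ` and `Δ′_{k+1}(μ) ≤ Δ′_k(μ) + e′·nsqv μ`, `Δ′_k := T_{Qkv T} Scv`, `Δ′_{k+1} := T_{Qkv T ∘ Q1v T′} Sfv`,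
`e = 2δ√(Λ·C_P(Λ+1)) + δ²·C_P(Λ+1)`, `δ = √d·(n·m)`, `e′ = (ε₁C_R + ε₂C_P)(Λ+1)`.  FED⁺ is DISCHARGED (`Scv_Q1v_le`); nothing of NE3. [folklore] -/
theorem colour_pair_bracket [FiniteDimensional ℂ E]
    {Rc : Tor (fine n M) → Fin d → (E →L[ℂ] E)} {R' : Tor (fine L (fine n M)) → Fin d → (E →L[ℂ] E)}
    {T : Tor (fine n M) → (E →L[ℂ] E)} {T' : Tor (fine L (fine n M)) → (E →L[ℂ] E)}
    (hR' : ∀ x μ, ‖R' x μ‖ ≤ 1) (hT1 : ∀ x, T' x ∈ unitary (E →L[ℂ] E)) {m : ℝ} (hm : 0 ≤ m)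
    (hmis : ∀ y μ j, ‖misv L (fine n M) Rc R' T' y μ j‖ ≤ m)
    {Λ CP CR ε₁ ε₂ : ℝ} (hΛ : 0 ≤ Λ) (hCP : 0 ≤ CP) (hCR : 0 ≤ CR) (hε₁ : 0 ≤ ε₁) (hε₂ : 0 ≤ ε₂) {ρ : (Tor (fine n M) → E) → ℝ}
    -- leaf UB⁺-colour at both levels (sibling: `VariationalColourUpperBound.exists_ubv_phys` shape)
    (hUBc : ∀ μ : Tor M → E, ∃ f, Qkv n M T f = μ ∧ Scv n M Rc f ≤ Λ * nsqv μ)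
    (hUBf : ∀ μ : Tor M → E, ∃ f', Qkv n M T (Q1v n L M T' f') = μ ∧ Sfv n L M R' f' ≤ Λ * nsqv μ)
    -- leaf P⁺-colour at both levels (OPEN in colour: V-COL-LIFT + frame ∕ local transport)
    (hPc : ∀ f, qWv n M f ≤ CP * (Scv n M Rc f + nsqv (Qkv n M T f)))
    (hPf : ∀ f', qVv n L M f' ≤ CP * (Sfv n L M R' f' + nsqv (Qkv n M T (Q1v n L M T' f'))))
    -- leaf ONE⁺-colour (sibling: `VariationalColourOneStepPhys.blockSpin_Q1v_le(_flat)` shape) and leaf REG⁺-colour (sibling: `VariationalColourBochner` line)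
    (hONE : ∀ f, blockSpin (Q1v n L M T') (Sfv n L M R') f ≤ Scv n M Rc f + ε₁ * ρ f + ε₂ * qWv n M f)
    (hREG : ∀ (μ : Tor M → E) f, Qkv n M T f = μ → (∀ g, Qkv n M T g = μ → Scv n M Rc f ≤ Scv n M Rc g) →
      ρ f ≤ CR * (Scv n M Rc f + nsqv μ))
    (μ : Tor M → E) :
    blockSpin (Qkv n M T) (Scv n M Rc) μ ≤ blockSpin (Qkv n M T ∘ Q1v n L M T') (Sfv n L M R') μ
        + (2 * (Real.sqrt d * ((n : ℝ) * m)) * Real.sqrt (Λ * (CP * (Λ + 1)))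
            + (Real.sqrt d * ((n : ℝ) * m)) ^ 2 * (CP * (Λ + 1))) * nsqv μ ∧
      blockSpin (Qkv n M T ∘ Q1v n L M T') (Sfv n L M R') μ ≤ blockSpin (Qkv n M T) (Scv n M Rc) μ
        + ((ε₁ * CR + ε₂ * CP) * (Λ + 1)) * nsqv μ := by
  have hL1 : (1 : ℝ) ≤ L := by exact_mod_cast Nat.one_le_iff_ne_zero.mpr (NeZero.ne L)
  have hnLd : (0 : ℝ) ≤ ((n : ℝ) * L) ^ d := by positivity
  have hδ : 0 ≤ Real.sqrt d * ((n : ℝ) * m) := by positivity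
  have hT' : ∀ x, ‖T' x‖ ≤ 1 := fun x => VariationalColourFederbush.norm_le_one_of_mem_unitary (hT1 x)
  have hnormW : ∀ f : Tor (fine n M) → E, ‖f‖ ^ 2 ≤ ((n : ℝ) * L) ^ d * qWv n M f := by
    intro f
    refine (norm_sq_le_qWv n M f).trans (mul_le_mul_of_nonneg_right ?_ (qWv_nonneg n M f))
    rw [mul_pow]
    exact le_mul_of_one_le_right (by positivity) (one_le_pow₀ hL1)
  have hnormV : ∀ f' : Tor (fine L (fine n M)) → E, ‖f'‖ ^ 2 ≤ ((n : ℝ) * L) ^ d * qVv n L M f' := norm_sq_le_qVv n L M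
  refine pair_bracket (V := Tor (fine L (fine n M)) → E) (W := Tor (fine n M) → E) (Z := Tor M → E)
    (Qk := Qkv n M T) (Q₁ := Q1v n L M T') (Sc := Scv n M Rc) (Sf := Sfv n L M R') (qW := qWv n M) (qV := qVv n L M) (qZ := nsqv) (ρ := ρ)
    (continuous_Qcv T) (continuous_Qcv T') ?_ ?_ (Q1v_surjective n L M T' hT1)
    (Scv_nonneg n M Rc) (Sfv_nonneg n L M R') (qVv_nonneg n L M) (fun μ => nsqv_nonneg μ)
    hnLd hΛ hCP hCR hδ hε₁ hε₂ hnormW hnormV hUBc hUBf hPc hPf ?_ hONE hREG μ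
  · exact continuous_sum_dirUv Rc _
  · exact continuous_sum_dirUv R' _
  · intro f'
    exact Scv_Q1v_le n L M hR' hT' hm hmis f'

end Summit.QuantumFields.BalabanUV.T4Continuum.VariationalColourScalarPair

end
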